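import Literature.IUT.HodgeTheaters.TemperedCoveringsCor23viHatIncidenceIffConjSeparating
import Literature.AnabelianGeometry.SemiGraphs.TemperedSeparatingQuotientOfCovering
import HarnessLib

/-!
# [IUTchI] Cor. 2.3 (vi): the pro-`Σ̂` incidence `hF` from a TWO-LEVEL finite-quotient separation — the criterion that
# survives at the «caveat» configurations where no quotient killing `Π^tp_ℍ` separates (proof-only)

S. Mochizuki, *Inter-universal Teichmüller theory I*, kurims manuscript (May 2020), §2, Cor. 2.3 (vi) p. 48 l. 6–16, proof
p. 49 l. 62–64 («by passing to pro-`Σ` completions») [cite: Mochizuki2012, Cor 2.3(vi) pp.48-49] (D-0012 claim key; series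
status DISPUTED; nothing of the series is asserted here); S. Mochizuki, *Semi-graphs of anabelioids*, Publ. RIMS **42**
(2006), §3 Prop. 3.6 (iii) p. 38 (finite objects of `B^temp(𝒢)` ↔ finite quotients of `π₁^temp(𝒢)`), Thm. 3.7 (i)/(iii)
pp. 40–41 (verticial / edge-like subgroups) [cite: MochizukiSemiAnbd2006, Prop 3.6(iii) p.38].

PROOF-ONLY file (abc-iut cell, seat abc-iut-L5-d5 gen 10, self-named count-neutral in-lineage row
«COR23VI-HF-TWO-LEVEL@CAVEAT», sequel of this lineage's R58 «COR23VI-HF-STRONG-NV» (p503446/p503925); cone row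
`IUTchI:Cor2.3(vi)` (discharged, RULINGS #118; residual `hF` = GAP-LEDGER G-w4d059-g8-1); no definition, no instance, no
notation, no new `Prop` fact).  Consumed BY NAME, never edited or restated: abc-iut-w4-d070's
`StableCurveTemperedData.exists_eq_of_mem_conj_sup`, `….not_map_le_conj_closure_of_forall_not_le_conj_sup`,
`….hatEdgeIncidence_of_conjSeparating` / `….hatCuspIncidence_of_conjSeparating` (p503058); abc-iut-L3-t11's kernel
dictionary `TemperedPiChart.exists_openNormal_ker_chartImage` (p502554); abc-iut-L3-t6's `decompSubgroups_singleVertex_eq`;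
abc-iut-L3-t2's `FiniteIsTempered_holds`.

THE POINT.  p498282 proved `hF` ⟸ «some finite quotient of `Π^tp_𝔾` KILLS `Π^tp_ℍ` but not the edge-like `L`» and
recorded (as did p503058 and abc-iut-w4-d070's GAP-LEDGER census D-G-w4d059-g8-1 of 2026-08-27T06:03:58Z) that this
one-level criterion FAILS exactly at the «caveat» configurations — an edge `e` with an end at a genus-`0`-type vertex
`u ∉ ℍ` all of whose other branches run into `ℍ`, where `Π_e ≤ ncl(Π^tp_ℍ)` — although `hF` holds there.  THIS FILE proves
the criterion that DOES work there, in three currencies: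

* §1 (group theory) `forall_not_le_conj_sup_inf_of_inf_le_of_not_inf_le` — **TWO-LEVEL SEPARATION**: for normal
  `U, N ⊴ Π` with `T ∩ N ≤ U` and `L ∩ N ≰ U`, the image of `L` in `Π/(U ∩ N)` lies in NO conjugate of the image of `T`
  (in `Q := Π/(U ∩ N)` the normal subgroup `M := N/(U ∩ N)` meets the image `W` of `T` — hence every conjugate of `W` —
  trivially, and the image of `L` non-trivially); finite-group reading `forall_not_le_conj_of_inf_eq_bot_of_inf_ne_bot`
  (`W ∩ M = 1`, `S ∩ M ≠ 1`, `M ⊴ Q` ⇒ `S` in no conjugate of `W`).  p498282's criterion is the case `N = Π` (`M = Q`);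
* §2 (any chart `c`, any `IsProfiniteCompletion ι`) `exists_openNormal_conjSeparating_of_twoLevel` — two open normal
  finite-index `U, N ⊴ Π^tp_𝔾` with `Π^tp_ℍ ∩ N ≤ U`, `L ∩ N ≰ U` yield abc-iut-w4-d070's conjugacy-separation binder
  `hconj`; `not_map_le_conj_closure_of_twoLevel`; **`hatEdgeIncidence_of_twoLevelSeparating`** — `hF` ⟸ `htwo` («for
  every edge not abutting `ℍ` and every edge-like `L` there are such `U, N`»), with the open-edge twin;
* §3 (coverings, `ℍ = ⟨{v}, ∅⟩`) `exists_twoLevel_of_coverings` — the two-level datum from a PAIR of tempered coverings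
  `S₁, S₂`: (a) every `γ ∈ Π_v` fixing `S₁_v` pointwise fixes `S₂_v` pointwise, (b) some `γ ∈ Π_e` fixes `S₁_e` pointwise
  and MOVES a point of `S₂_e` — then `N := Ker c(S₁)`, `U := Ker c(S₂)` do it for every verticial `T` at `v` and every
  edge-like `L` at `e`; `twoLevelSeparating_singleVertex_of_coverings` / `…_of_finiteCoverings` (one PAIR of finite
  `CovObj`s per non-abutting edge, under [SemiAnbd] Prop. 3.6's hypotheses); assembly
  **`hatEdgeIncidence_singleVertex_of_finiteCoveringPairs`** — `hF` at `(c, ι, ⟨{v}, ∅⟩, Π^tp_ℍ)` from covering pairs.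

READING (docstring only; finite quotients = Galois groups of finite étale Galois coverings, [SemiAnbd] §3): `S₁` is a
first finite étale covering `𝒢₁ → 𝒢` — ARBITRARY over `ℍ` — and `S₂ → S₁` a second one that is SPLIT over the preimage
of `ℍ` but NOT split at some lift of `e`; at a caveat vertex one takes `S₁` cyclic of prime degree `ℓ ∈ Σ` with `u`
totally inert and `e` totally split, and `S₂` the `𝔽_ℓ`-torsor whose monodromy is the `𝔽_ℓ`-flow through two lifts of
`e` (monodromy group inside `𝔽_ℓ ≀ 𝔽_ℓ`); the sequel file exhibits this IN THE KERNEL at a model carrier where the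
one-level criterion provably fails.  So G-w4d059-g8-1 is NOT discharged here (the genuine `S.Gc` is abstract
`Thm37Hypotheses` data); its residual is REDUCED from «profinite Bass–Serre / subgroup-into-conjugacy separability» to
the existence of such covering PAIRS.  Model-RELATIVE at the genuine datum; typed ≠ discharged for the [IUTchI] claim
keys; nothing here bears on [IUTchIII] Cor. 3.12 or asserts that abc is proved or refuted.
-/

noncomputable section

namespace Literature.IUT.HodgeTheaters

open _root_.Topology
open scoped Pointwise
open Literature.AnabelianGeometry.SemiGraphs
open Literature.AnabelianGeometry.SemiGraphs.ProfiniteSemiGraph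

universe u v

namespace StableCurveTemperedData

section Algebra

variable {G : Type u} [Group G] (T : Subgroup G)

/-- **TWO-LEVEL SEPARATION, group form.**  Let `U, N ⊴ Π` be normal with `T ∩ N ≤ U` and `L ∩ N ≰ U`.  Then the image
of `L` in `Π/(U ∩ N)` lies in NO conjugate of the image of `T`: `L ≰ (t T t⁻¹)·(U ∩ N)` for every `t ∈ Π`.  (In the finite
quotient `Q := Π/(U ∩ N)` the normal subgroup `M := N/(U ∩ N)` meets the image `W` of `T` trivially but the image of `L`
non-trivially; a conjugate of `W` meets `M` trivially as well.) [cite: MochizukiSemiAnbd2006, Prop 3.6(iii) p.38] -/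
theorem forall_not_le_conj_sup_inf_of_inf_le_of_not_inf_le (L U N : Subgroup G) [U.Normal] [N.Normal]
    (hT : T ⊓ N ≤ U) (hL : ¬ L ⊓ N ≤ U) : ∀ t : G, ¬ L ≤ MulAut.conj t • T ⊔ (U ⊓ N) := by
  intro t h
  apply hL
  rintro y ⟨hyL, hyN⟩
  obtain ⟨s, hs, u, hu, hy⟩ := exists_eq_of_mem_conj_sup T (U ⊓ N) (h hyL)
  -- `t s t⁻¹ = y u⁻¹ ∈ N`, hence `s ∈ T ∩ N ≤ U`, hence `y ∈ U`
  have htst : t * s * t⁻¹ ∈ N := by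
    have : t * s * t⁻¹ = y * u⁻¹ := by rw [hy, mul_inv_cancel_right]
    rw [this]
    exact N.mul_mem hyN (N.inv_mem hu.2)
  have hsN : s ∈ N := by
    have := ‹N.Normal›.conj_mem _ htst t⁻¹
    simpa [mul_assoc] using this
  have hsU : s ∈ U := hT ⟨hs, hsN⟩
  rw [hy]
  exact U.mul_mem (‹U.Normal›.conj_mem s hsU t) hu.1

/-- **Finite-quotient reading.**  In a group `Q` let `M ⊴ Q` be normal, `W ≤ Q` with `W ∩ M = 1`, and `S ≤ Q` with
`S ∩ M ≠ 1`.  Then `S` lies in no conjugate of `W`. [cite: MochizukiSemiAnbd2006, Prop 3.6(iii) p.38] -/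
theorem forall_not_le_conj_of_inf_eq_bot_of_inf_ne_bot {Q : Type u} [Group Q] (W S M : Subgroup Q) [M.Normal]
    (hW : W ⊓ M = ⊥) (hS : S ⊓ M ≠ ⊥) : ∀ q : Q, ¬ S ≤ MulAut.conj q • W := by
  intro q h
  have h' := forall_not_le_conj_sup_inf_of_inf_le_of_not_inf_le W S ⊥ M hW.le
    (fun hle => hS (le_bot_iff.mp hle)) q
  apply h'
  simpa using h

end Algebra

/-! ### 2. `hF` from TWO-LEVEL separation, at any chart and any profinite completion -/

section Chart

variable {𝒢 : ProfiniteSemiGraph.{u}} (c : TemperedPiChart 𝒢) {Ghat : Type v} [Group Ghat] [TopologicalSpace Ghat]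
  [IsTopologicalGroup Ghat] {ι : c.G →ₜ* Ghat} (hι : IsProfiniteCompletion ι)
  (H : 𝒢.graph.Subgraph) (TpH : Subgroup c.G)

/-- **Two open normal finite-index subgroups `U, N ⊴ Π^tp_𝔾` with `Π^tp_ℍ ∩ N ≤ U` and `L ∩ N ≰ U` conjugacy-separate `L`
from `Π^tp_ℍ` in the finite quotient `Π^tp_𝔾/(U ∩ N)`** — abc-iut-w4-d070's binder `hconj` (p503058) from the two-level
datum. [cite: MochizukiSemiAnbd2006, Prop 3.6(iii) p.38] -/
theorem exists_openNormal_conjSeparating_of_twoLevel {L : Subgroup c.G} (U N : OpenNormalSubgroup c.G)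
    (hU : U.toSubgroup.FiniteIndex) (hN : N.toSubgroup.FiniteIndex) (hT : TpH ⊓ N.toSubgroup ≤ U.toSubgroup)
    (hL : ¬ L ⊓ N.toSubgroup ≤ U.toSubgroup) :
    ∃ V : OpenNormalSubgroup c.G, V.toSubgroup.FiniteIndex ∧ ∀ t : c.G, ¬ L ≤ MulAut.conj t • TpH ⊔ V.toSubgroup := by
  haveI := hU
  haveI := hN
  exact ⟨U ⊓ N, (inferInstance : (U.toSubgroup ⊓ N.toSubgroup).FiniteIndex),
    forall_not_le_conj_sup_inf_of_inf_le_of_not_inf_le TpH L U.toSubgroup N.toSubgroup hT hL⟩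

include hι in
/-- **Two-level separation in the profinite completion**: if open normal finite-index `U, N ⊴ Π^tp_𝔾` have
`Π^tp_ℍ ∩ N ≤ U` and `L ∩ N ≰ U`, then `ι(L)` lies in NO `Π̂_𝔾`-conjugate of the closure of `ι(Π^tp_ℍ)` (p498282's
`not_map_le_conj_closure_of_openNormal` is the case `N = Π^tp_𝔾`). [cite: MochizukiSemiAnbd2006, Prop 3.6(iii) p.38] -/
theorem not_map_le_conj_closure_of_twoLevel {L : Subgroup c.G} (U N : OpenNormalSubgroup c.G)
    (hU : U.toSubgroup.FiniteIndex) (hN : N.toSubgroup.FiniteIndex) (hT : TpH ⊓ N.toSubgroup ≤ U.toSubgroup)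
    (hL : ¬ L ⊓ N.toSubgroup ≤ U.toSubgroup) (g : Ghat) :
    ¬ L.map ι.toMonoidHom ≤ MulAut.conj g • (TpH.map ι.toMonoidHom).topologicalClosure := by
  obtain ⟨V, hV, hsep⟩ := exists_openNormal_conjSeparating_of_twoLevel c TpH U N hU hN hT hL
  exact not_map_le_conj_closure_of_forall_not_le_conj_sup hι TpH L V hV hsep g

include hι in
/-- **`hF` ⟸ TWO-LEVEL SEPARATION** (sufficient criterion, WEAKER hypothesis than p498282's
`hatEdgeIncidence_of_openNormalSeparating`, which is its case `N = ⊤`): if for every edge `e` no branch of which abuts a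
vertex of `ℍ` and every edge-like `L` at `e` there are open normal finite-index `U, N ⊴ Π^tp_𝔾` with `Π^tp_ℍ ∩ N ≤ U` and
`L ∩ N ≰ U` (a finite quotient of `Π^tp_𝔾` with a NORMAL subgroup meeting the image of `Π^tp_ℍ` trivially and the image of
`L` non-trivially), then the pro-`Σ̂` edge–subgraph incidence `hF` (GAP-LEDGER G-w4d059-g8-1, abc-iut-w4-d059's shape)
holds at `(c, ι, ℍ, Π^tp_ℍ)`. [cite: MochizukiSemiAnbd2006, Prop 3.6(iii) p.38] -/
theorem hatEdgeIncidence_of_twoLevelSeparating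
    (htwo : ∀ e : 𝒢.graph.Edge,
      (¬ ∃ b : 𝒢.graph.Branch, 𝒢.graph.edgeOf b = e ∧ ∃ w ∈ H.verts, 𝒢.graph.abuts b = some w) →
      ∀ L ∈ edgeLikeSubgroups c e, ∃ U N : OpenNormalSubgroup c.G,
        U.toSubgroup.FiniteIndex ∧ N.toSubgroup.FiniteIndex ∧
          TpH ⊓ N.toSubgroup ≤ U.toSubgroup ∧ ¬ L ⊓ N.toSubgroup ≤ U.toSubgroup) :
    ∀ e : 𝒢.graph.Edge, ∀ L ∈ edgeLikeSubgroups c e, ∀ g : Ghat,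
      L.map ι.toMonoidHom ≤ MulAut.conj g • (TpH.map ι.toMonoidHom).topologicalClosure →
        ∃ b : 𝒢.graph.Branch, 𝒢.graph.edgeOf b = e ∧ ∃ w ∈ H.verts, 𝒢.graph.abuts b = some w := by
  refine hatEdgeIncidence_of_conjSeparating c hι H TpH fun e he L hL => ?_
  obtain ⟨U, N, hU, hN, hT, hLU⟩ := htwo e he L hL
  exact exists_openNormal_conjSeparating_of_twoLevel c TpH U N hU hN hT hLU

include hι in
/-- **Open-edge twin** (for abc-iut-w4-d059's `hFcusp`): two-level separation is asked only of the OPEN edges not abutting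
`ℍ`. [cite: MochizukiSemiAnbd2006, Prop 3.6(iii) p.38] -/
theorem hatCuspIncidence_of_twoLevelSeparating
    (htwo : ∀ e : 𝒢.graph.Edge, (∃ b₀ : 𝒢.graph.Branch, 𝒢.graph.edgeOf b₀ = e ∧ 𝒢.graph.abuts b₀ = none) →
      (¬ ∃ b : 𝒢.graph.Branch, 𝒢.graph.edgeOf b = e ∧ ∃ w ∈ H.verts, 𝒢.graph.abuts b = some w) →
      ∀ L ∈ edgeLikeSubgroups c e, ∃ U N : OpenNormalSubgroup c.G,
        U.toSubgroup.FiniteIndex ∧ N.toSubgroup.FiniteIndex ∧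
          TpH ⊓ N.toSubgroup ≤ U.toSubgroup ∧ ¬ L ⊓ N.toSubgroup ≤ U.toSubgroup) :
    ∀ e : 𝒢.graph.Edge, (∃ b₀ : 𝒢.graph.Branch, 𝒢.graph.edgeOf b₀ = e ∧ 𝒢.graph.abuts b₀ = none) →
      ∀ L ∈ edgeLikeSubgroups c e, ∀ g : Ghat,
        L.map ι.toMonoidHom ≤ MulAut.conj g • (TpH.map ι.toMonoidHom).topologicalClosure →
          ∃ b : 𝒢.graph.Branch, 𝒢.graph.edgeOf b = e ∧ ∃ w ∈ H.verts, 𝒢.graph.abuts b = some w := by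
  refine hatCuspIncidence_of_conjSeparating c hι H TpH fun e he₀ he L hL => ?_
  obtain ⟨U, N, hU, hN, hT, hLU⟩ := htwo e he₀ he L hL
  exact exists_openNormal_conjSeparating_of_twoLevel c TpH U N hU hN hT hLU

end Chart

/-! ### 3. The two-level datum from TWO coverings, at the single-vertex sub-semi-graph `ℍ = ⟨{v}, ∅⟩` -/

section Coverings

variable {𝒢 : ProfiniteSemiGraph.{u}}

/-- **TWO-LEVEL SEPARATION FROM TWO COVERINGS** ([SemiAnbd] Prop. 3.6 (iii), Thm. 3.7 (i)/(iii), read in `B^temp(𝒢)`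
through abc-iut-L3-t11's kernel dictionary `TemperedPiChart.exists_openNormal_ker_chartImage`).  Let `S₁, S₂` be tempered
coverings with finite fibres at `v` such that (a) every `γ ∈ Π_v` fixing `S₁_v` pointwise fixes `S₂_v` pointwise, and
(b) some `γ ∈ Π_e` fixes `S₁_e` pointwise but MOVES a point of `S₂_e`.  Then for the kernels `N := Ker c(S₁)`,
`U := Ker c(S₂)` — open normal of finite index — every verticial `T` at `v` has `T ∩ N ≤ U` and every edge-like `L` at `e`
has `L ∩ N ≰ U`. [cite: MochizukiSemiAnbd2006, Thm 3.7(iii) p.41] -/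
theorem exists_twoLevel_of_coverings (c : TemperedPiChart 𝒢) (S₁ S₂ : BTempCat 𝒢) {v : 𝒢.graph.Vertex}
    [Finite (S₁.obj.SV v).obj.V] [Finite (S₂.obj.SV v).obj.V]
    (hdom : ∀ γ : 𝒢.Gv v, (∀ s, (S₁.obj.SV v).obj.ρ γ s = s) → ∀ s, (S₂.obj.SV v).obj.ρ γ s = s)
    {e : 𝒢.graph.Edge}
    (hmove : ∃ γ : 𝒢.Ge e, (∀ s, (S₁.obj.SE e).obj.ρ γ s = s) ∧ ∃ s, (S₂.obj.SE e).obj.ρ γ s ≠ s)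
    {T : Subgroup c.G} (hT : T ∈ verticialSubgroups c v) :
    ∃ U N : OpenNormalSubgroup c.G, U.toSubgroup.FiniteIndex ∧ N.toSubgroup.FiniteIndex ∧
      T ⊓ N.toSubgroup ≤ U.toSubgroup ∧ ∀ L ∈ edgeLikeSubgroups c e, ¬ L ⊓ N.toSubgroup ≤ U.toSubgroup := by
  obtain ⟨ψ, hψ, rfl⟩ := hT
  obtain ⟨U, hU, -, hV₂, hE₂⟩ := TemperedPiChart.exists_openNormal_ker_chartImage c S₂ hψ
  obtain ⟨N, hN, -, hV₁, hE₁⟩ := TemperedPiChart.exists_openNormal_ker_chartImage c S₁ hψ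
  refine ⟨U, N, hU, hN, ?_, fun L hL hle => ?_⟩
  · rintro _ ⟨⟨γ, rfl⟩, hγN⟩
    exact (hV₂ v ψ hψ γ).2 (hdom γ ((hV₁ v ψ hψ γ).1 hγN))
  · obtain ⟨ψe, hψe, rfl⟩ := hL
    obtain ⟨γ, hfix, s, hs⟩ := hmove
    have hγN : ψe γ ∈ N.toSubgroup := (hE₁ e ψe hψe γ).2 hfix
    have hγU : ψe γ ∈ U.toSubgroup := hle ⟨⟨γ, rfl⟩, hγN⟩
    exact hs ((hE₂ e ψe hψe γ).1 hγU s)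

/-- **The same for the decomposition subgroups `Π^tp_{{v}}` of the edgeless single-vertex sub-semi-graph `⟨{v}, ∅⟩`**
([IUTchI] §2 p. 44), which ARE the verticial subgroups at `v` for `𝒢` quasi-coherent and Galois-countable
(abc-iut-L3-t6's `decompSubgroups_singleVertex_eq`). [cite: Mochizuki2012, IUTchI §2 p.44] -/
theorem exists_twoLevel_decomp_singleVertex_of_coverings (hqc : 𝒢.IsQuasiCoherent) (hgc : 𝒢.IsGaloisCountable)
    (c : TemperedPiChart 𝒢) (S₁ S₂ : BTempCat 𝒢) {v : 𝒢.graph.Vertex}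
    [Finite (S₁.obj.SV v).obj.V] [Finite (S₂.obj.SV v).obj.V]
    (hdom : ∀ γ : 𝒢.Gv v, (∀ s, (S₁.obj.SV v).obj.ρ γ s = s) → ∀ s, (S₂.obj.SV v).obj.ρ γ s = s)
    {e : 𝒢.graph.Edge}
    (hmove : ∃ γ : 𝒢.Ge e, (∀ s, (S₁.obj.SE e).obj.ρ γ s = s) ∧ ∃ s, (S₂.obj.SE e).obj.ρ γ s ≠ s)
    {D : Subgroup c.G} (hD : D ∈ c.decompSubgroups ⟨{v}, ∅⟩) :
    ∃ U N : OpenNormalSubgroup c.G, U.toSubgroup.FiniteIndex ∧ N.toSubgroup.FiniteIndex ∧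
      D ⊓ N.toSubgroup ≤ U.toSubgroup ∧ ∀ L ∈ edgeLikeSubgroups c e, ¬ L ⊓ N.toSubgroup ≤ U.toSubgroup :=
  exists_twoLevel_of_coverings c S₁ S₂ hdom hmove
    ((TemperedPiChart.decompSubgroups_singleVertex_eq hqc hgc c v).symm ▸ hD : D ∈ verticialSubgroups c v)

/-- **The two-level separation binder at `ℍ := ⟨{v}, ∅⟩ DISCHARGED FROM COVERING PAIRS**: if for every edge `e` no branch
of which abuts `v` there are tempered coverings `S₁, S₂` with finite `v`-fibres satisfying (a) and (b) of
`exists_twoLevel_of_coverings`, then for every such `e`, every edge-like `L` at `e` and any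
`Π^tp_ℍ := TpH ∈ decompSubgroups c ⟨{v}, ∅⟩` there are open normal finite-index `U, N` with `TpH ∩ N ≤ U`, `L ∩ N ≰ U`.
[cite: MochizukiSemiAnbd2006, Prop 3.6(iii) p.38] -/
theorem twoLevelSeparating_singleVertex_of_coverings (hqc : 𝒢.IsQuasiCoherent) (hgc : 𝒢.IsGaloisCountable)
    (c : TemperedPiChart 𝒢) (v : 𝒢.graph.Vertex) (TpH : Subgroup c.G) (hTpH : TpH ∈ c.decompSubgroups ⟨{v}, ∅⟩)
    (hcov : ∀ e : 𝒢.graph.Edge,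
      (¬ ∃ b : 𝒢.graph.Branch, 𝒢.graph.edgeOf b = e ∧
          ∃ w ∈ (⟨{v}, ∅⟩ : 𝒢.graph.Subgraph).verts, 𝒢.graph.abuts b = some w) →
      ∃ S₁ S₂ : BTempCat 𝒢, Finite (S₁.obj.SV v).obj.V ∧ Finite (S₂.obj.SV v).obj.V ∧
        (∀ γ : 𝒢.Gv v, (∀ s, (S₁.obj.SV v).obj.ρ γ s = s) → ∀ s, (S₂.obj.SV v).obj.ρ γ s = s) ∧
        ∃ γ : 𝒢.Ge e, (∀ s, (S₁.obj.SE e).obj.ρ γ s = s) ∧ ∃ s, (S₂.obj.SE e).obj.ρ γ s ≠ s) :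
    ∀ e : 𝒢.graph.Edge,
      (¬ ∃ b : 𝒢.graph.Branch, 𝒢.graph.edgeOf b = e ∧
          ∃ w ∈ (⟨{v}, ∅⟩ : 𝒢.graph.Subgraph).verts, 𝒢.graph.abuts b = some w) →
      ∀ L ∈ edgeLikeSubgroups c e, ∃ U N : OpenNormalSubgroup c.G,
        U.toSubgroup.FiniteIndex ∧ N.toSubgroup.FiniteIndex ∧
          TpH ⊓ N.toSubgroup ≤ U.toSubgroup ∧ ¬ L ⊓ N.toSubgroup ≤ U.toSubgroup := by
  intro e he L hL
  obtain ⟨S₁, S₂, hfin₁, hfin₂, hdom, hmove⟩ := hcov e he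
  haveI := hfin₁
  haveI := hfin₂
  obtain ⟨U, N, hU, hN, hT, hLU⟩ := exists_twoLevel_decomp_singleVertex_of_coverings hqc hgc c S₁ S₂ hdom hmove hTpH
  exact ⟨U, N, hU, hN, hT, hLU L hL⟩

/-- **FINITE-COVERING form** (the consumer's entry point): under the hypotheses of [SemiAnbd] Prop. 3.6 every FINITE
object of `B^cov(𝒢)` is tempered (abc-iut-L3-t2's `FiniteIsTempered_holds`), so the two-level binder at `ℍ := ⟨{v}, ∅⟩`
follows from: for every edge `e` not abutting `v`, ONE PAIR of finite `S₁ S₂ : CovObj 𝒢` with (a) `Π_v`-fixed points of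
`S₁_v` ⇒ of `S₂_v` elementwise and (b) some `γ ∈ Π_e` fixing `S₁_e` pointwise and moving `S₂_e`.
[cite: MochizukiSemiAnbd2006, Def 3.5(ii) p.37] -/
theorem twoLevelSeparating_singleVertex_of_finiteCoverings (h36 : 𝒢.Prop36Hypotheses)
    (c : TemperedPiChart 𝒢) (v : 𝒢.graph.Vertex) (TpH : Subgroup c.G) (hTpH : TpH ∈ c.decompSubgroups ⟨{v}, ∅⟩)
    (hcov : ∀ e : 𝒢.graph.Edge,
      (¬ ∃ b : 𝒢.graph.Branch, 𝒢.graph.edgeOf b = e ∧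
          ∃ w ∈ (⟨{v}, ∅⟩ : 𝒢.graph.Subgraph).verts, 𝒢.graph.abuts b = some w) →
      ∃ S₁ S₂ : CovObj 𝒢, S₁.IsFinite ∧ S₂.IsFinite ∧
        (∀ γ : 𝒢.Gv v, (∀ s, (S₁.SV v).obj.ρ γ s = s) → ∀ s, (S₂.SV v).obj.ρ γ s = s) ∧
        ∃ γ : 𝒢.Ge e, (∀ s, (S₁.SE e).obj.ρ γ s = s) ∧ ∃ s, (S₂.SE e).obj.ρ γ s ≠ s) :
    ∀ e : 𝒢.graph.Edge,
      (¬ ∃ b : 𝒢.graph.Branch, 𝒢.graph.edgeOf b = e ∧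
          ∃ w ∈ (⟨{v}, ∅⟩ : 𝒢.graph.Subgraph).verts, 𝒢.graph.abuts b = some w) →
      ∀ L ∈ edgeLikeSubgroups c e, ∃ U N : OpenNormalSubgroup c.G,
        U.toSubgroup.FiniteIndex ∧ N.toSubgroup.FiniteIndex ∧
          TpH ⊓ N.toSubgroup ≤ U.toSubgroup ∧ ¬ L ⊓ N.toSubgroup ≤ U.toSubgroup := by
  refine twoLevelSeparating_singleVertex_of_coverings h36.isQuasiCoherent h36.isGaloisCountable c v TpH hTpH
    fun e he => ?_
  obtain ⟨S₁, S₂, hS₁, hS₂, hdom, hmove⟩ := hcov e he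
  exact ⟨⟨S₁, FiniteIsTempered_holds 𝒢 h36.isConnected h36.isCountable S₁ hS₁⟩,
    ⟨S₂, FiniteIsTempered_holds 𝒢 h36.isConnected h36.isCountable S₂ hS₂⟩, hS₁.finite_V v, hS₂.finite_V v, hdom, hmove⟩

/-- **`hF` AT `ℍ = ⟨{v}, ∅⟩` FROM FINITE COVERING PAIRS** (any chart, any profinite completion, [SemiAnbd] Prop. 3.6
hypotheses): the composite of `twoLevelSeparating_singleVertex_of_finiteCoverings` and
`hatEdgeIncidence_of_twoLevelSeparating`. [cite: MochizukiSemiAnbd2006, Prop 3.6(iii) p.38] -/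
theorem hatEdgeIncidence_singleVertex_of_finiteCoveringPairs (h36 : 𝒢.Prop36Hypotheses) (c : TemperedPiChart 𝒢)
    {Ghat : Type v} [Group Ghat] [TopologicalSpace Ghat] [IsTopologicalGroup Ghat] {ι : c.G →ₜ* Ghat}
    (hι : IsProfiniteCompletion ι) (v : 𝒢.graph.Vertex) (TpH : Subgroup c.G)
    (hTpH : TpH ∈ c.decompSubgroups ⟨{v}, ∅⟩)
    (hcov : ∀ e : 𝒢.graph.Edge,
      (¬ ∃ b : 𝒢.graph.Branch, 𝒢.graph.edgeOf b = e ∧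
          ∃ w ∈ (⟨{v}, ∅⟩ : 𝒢.graph.Subgraph).verts, 𝒢.graph.abuts b = some w) →
      ∃ S₁ S₂ : CovObj 𝒢, S₁.IsFinite ∧ S₂.IsFinite ∧
        (∀ γ : 𝒢.Gv v, (∀ s, (S₁.SV v).obj.ρ γ s = s) → ∀ s, (S₂.SV v).obj.ρ γ s = s) ∧
        ∃ γ : 𝒢.Ge e, (∀ s, (S₁.SE e).obj.ρ γ s = s) ∧ ∃ s, (S₂.SE e).obj.ρ γ s ≠ s) :
    ∀ e : 𝒢.graph.Edge, ∀ L ∈ edgeLikeSubgroups c e, ∀ g : Ghat,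
      L.map ι.toMonoidHom ≤ MulAut.conj g • (TpH.map ι.toMonoidHom).topologicalClosure →
        ∃ b : 𝒢.graph.Branch, 𝒢.graph.edgeOf b = e ∧
          ∃ w ∈ (⟨{v}, ∅⟩ : 𝒢.graph.Subgraph).verts, 𝒢.graph.abuts b = some w :=
  hatEdgeIncidence_of_twoLevelSeparating c hι ⟨{v}, ∅⟩ TpH
    (twoLevelSeparating_singleVertex_of_finiteCoverings h36 c v TpH hTpH hcov)

end Coverings

end StableCurveTemperedData

end Literature.IUT.HodgeTheaters
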